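import Summits.BirchSwinnertonDyer.BirchSwinnertonDyer.Theorems.Rank2ObservatoryRank2Table

/-!
# BirchSwinnertonDyer — rank ≥ 2 observatory: the coset witness for independence of two points

HONEST FRAMING: per-curve certified theorems and census instruments; no claim on BSD in rank ≥ 2.

Every engine-P rank-2 certificate of the census (schema `bsdr2-cert-1/v1`, field
`rank_lower.method_v2`; `346 187` of the `348 672` curves) and every engine-B certificate proves
that the two listed generators `P₁, P₂ ∈ E(ℚ)` are `ℤ`-independent by a finite-field COSET
WITNESS: with `t = gcd_ℓ #E(𝔽_ℓ)` over good odd primes `ℓ` — a multiple of `#E(ℚ)_tors` by the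
injectivity of torsion under good reduction (Silverman AEC VII.3.1(b)) — written `t = 2^u · m` with
`m` odd, the certificate prints for each `e ∈ {(1,0), (0,1), (1,1)}` a good odd prime `q` with
`(e₁P₁ + e₂P₂) mod q ∉ 2E(𝔽_q) + E(𝔽_q)[2^u]`.

This file proves the ALGEBRA of that criterion once, for an arbitrary additive commutative group `A`
(the Mordell–Weil group), arbitrary targets `B₁, B₂, B₃` (the groups `E(𝔽_q)`) and arbitrary
homomorphisms `φᵢ : A →+ Bᵢ` (the reduction maps):

* `twoCoset B u` — the subgroup `2•B + B[2^u] = {2•b + c | 2^u • c = 0}`;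
* `mem_twoCoset_of_zsmul_eq_zero` — an element killed by `2^u * m`, `m` odd, lies in `twoCoset _ u`
  (Bezout for `2^u` and `m`; an element of odd order is divisible by `2`);
* `mem_twoCoset_of_odd_zsmul_mem` — odd multiples are invertible modulo a subgroup containing `2•B`;
* `linearIndependent_pair_of_cosetWitness` — if every element of finite order of `A` is killed by
  `2^u * m` (`m` odd) and `φ₁ P₁`, `φ₂ P₂`, `φ₃ (P₁ + P₂)` avoid `twoCoset Bᵢ u`, then
  `LinearIndependent ℤ ![P₁, P₂]`. Proof: divide a dependency `a•P₁ + b•P₂ = 0`, `(a,b) ≠ 0`, by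
  `gcd(a,b)`; the primitive combination `Q = a'•P₁ + b'•P₂` has finite order, so lies in
  `twoCoset A u`, and so does each `φᵢ Q`; `a', b'` are not both even, and in each of the three
  remaining parity cases one of `φ₁ P₁`, `φ₂ P₂`, `φ₃ (P₁+P₂)` is an odd multiple away from
  `φᵢ Q` modulo `2•Bᵢ` — contradicting the corresponding witness;
* `two_le_mordellWeilRank_of_cosetWitness` / `Rank2Row.two_le_mordellWeilRank_of_cosetWitness` —
  composed with `two_le_mordellWeilRank_of_linearIndependent` (Mordell–Weil PROVED in the tree):
  the witness hypotheses give `2 ≤ rank_ℤ E(ℚ)`, i.e. they discharge the named hypothesis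
  `hind` / `hlow` of the census row theorems (`Rank2ObservatoryRank2Table.lean`,
  `Rank2ObservatoryRank2Census.lean`) down to the existence of three homomorphisms out of `E(ℚ)`
  with the printed values and the torsion annihilator `t`.

What remains OUTSIDE Lean after this file (stated, not formalised): that reduction modulo a good
prime `q` is a group homomorphism `E(ℚ) →+ E(𝔽_q)` taking the listed generators to the printed
points, the point counts `#E(𝔽_ℓ)`, and the injectivity of torsion — the certificate's hypothesis
key `TORSION_INJECTS` and its exact finite-field arithmetic, re-verified by the second engine.

References: J. H. Silverman, *The Arithmetic of Elliptic Curves* (2nd ed. 2009), VII.3.1(b);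
J. E. Cremona, *Algorithms for Modular Elliptic Curves* (2nd ed. 1997), §3.5 (independent points
"independent modulo 2"); cell files `code/cert1-engineP/ffcurve.py` (`witness_independence_v2`),
`code/cert3-engineB` (the `2`-adic coset criterion), paper draft
`b2b-bsdr2-cert-1/paper-draft-rank2-engineP.tex` (Lemma "coset witness").
-/

-- single-conjunct summit: `Summit.BirchSwinnertonDyer.BirchSwinnertonDyer.…` repeats the name by design
set_option linter.dupNamespace false

namespace Summit.BirchSwinnertonDyer.BirchSwinnertonDyer.Rank2Observatory

open WeierstrassCurve

/-! ### The subgroup `2•B + B[2^u]` -/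

section Algebra

variable {A : Type*} [AddCommGroup A]

/-- The subgroup `2•B + B[2^u] = {2•b + c | 2^u • c = 0}` of an additive commutative group `B`
(for `B = E(𝔽_q)`: the cosets the certificate's witness must avoid). [folklore] -/
def twoCoset (B : Type*) [AddCommGroup B] (u : ℕ) : AddSubgroup B where
  carrier := {y | ∃ b c : B, ((2 : ℤ) ^ u) • c = 0 ∧ y = (2 : ℤ) • b + c}
  add_mem' := by
    rintro _ _ ⟨b, c, hc, rfl⟩ ⟨b', c', hc', rfl⟩
    refine ⟨b + b', c + c', by rw [smul_add, hc, hc', add_zero], ?_⟩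
    rw [smul_add]
    abel
  zero_mem' := ⟨0, 0, by rw [smul_zero], by rw [smul_zero, add_zero]⟩
  neg_mem' := by
    rintro _ ⟨b, c, hc, rfl⟩
    exact ⟨-b, -c, by rw [smul_neg, hc, neg_zero], by rw [smul_neg, neg_add]⟩

/-- Membership in `twoCoset`, definitionally. [folklore] -/
theorem mem_twoCoset_iff {B : Type*} [AddCommGroup B] {u : ℕ} {y : B} :
    y ∈ twoCoset B u ↔ ∃ b c : B, ((2 : ℤ) ^ u) • c = 0 ∧ y = (2 : ℤ) • b + c :=
  Iff.rfl

/-- `2•A ⊆ twoCoset A u`. [folklore] -/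
theorem two_zsmul_mem_twoCoset (u : ℕ) (b : A) : (2 : ℤ) • b ∈ twoCoset A u :=
  ⟨b, 0, by rw [smul_zero], by rw [add_zero]⟩

/-- **Odd multiples are invertible modulo `twoCoset`**: if `a` is odd and `a • x ∈ twoCoset A u`
then `x ∈ twoCoset A u` (because `x = a • x - 2 • (k • x)` for `a = 2k + 1`). [folklore] -/
theorem mem_twoCoset_of_odd_zsmul_mem {u : ℕ} {a : ℤ} (ha : Odd a) {x : A}
    (h : a • x ∈ twoCoset A u) : x ∈ twoCoset A u := by
  obtain ⟨k, rfl⟩ := ha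
  have e : x = (2 * k + 1) • x - (2 : ℤ) • (k • x) := by module
  rw [e]
  exact sub_mem h (two_zsmul_mem_twoCoset u (k • x))

/-- **An element killed by `2^u * m` with `m` odd lies in `2•A + A[2^u]`**: with
`α 2^u + β m = 1` (Bezout) and `m = 2k + 1`, `x = 2 • (α(k+1) • 2^u • x) + (β m) • x`, where
`2^u • (β m • x) = β • (2^u m • x) = 0` and `m • (2^u • x) = 0` makes `2^u • x` divisible by `2`.
[folklore] -/
theorem mem_twoCoset_of_zsmul_eq_zero {u : ℕ} {m : ℤ} (hm : Odd m) {x : A}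
    (hx : ((2 : ℤ) ^ u * m) • x = 0) : x ∈ twoCoset A u := by
  obtain ⟨k, hk⟩ := hm
  have hcop : IsCoprime ((2 : ℤ) ^ u) m := by
    have h2 : IsCoprime (2 : ℤ) m := ⟨-k, 1, by rw [hk]; ring⟩
    exact h2.pow_left
  obtain ⟨α, β, hαβ⟩ := hcop
  refine ⟨(α * (k + 1)) • (((2 : ℤ) ^ u) • x), (β * m) • x, ?_, ?_⟩
  · rw [← mul_smul, show (2 : ℤ) ^ u * (β * m) = β * ((2 : ℤ) ^ u * m) by ring, mul_smul, hx,
      smul_zero]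
  · have e : (2 : ℤ) • ((α * (k + 1)) • (((2 : ℤ) ^ u) • x)) + (β * m) • x
        = α • (((2 : ℤ) ^ u * m) • x) + (α * (2 : ℤ) ^ u + β * m) • x := by
      rw [hk]
      module
    rw [e, hx, smul_zero, zero_add, hαβ, one_smul]

/-- Images: if `(2^u m) • x = 0` in `A` then `φ x ∈ twoCoset B u` for any homomorphism `φ`.
[folklore] -/
theorem map_mem_twoCoset_of_zsmul_eq_zero {B : Type*} [AddCommGroup B] (φ : A →+ B) {u : ℕ}
    {m : ℤ} (hm : Odd m) {x : A} (hx : ((2 : ℤ) ^ u * m) • x = 0) : φ x ∈ twoCoset B u :=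
  mem_twoCoset_of_zsmul_eq_zero hm (by rw [← map_zsmul, hx, map_zero])

/-! ### The coset witness implies independence -/

/-- **Coset witness ⇒ `ℤ`-independence of two points.** Let every element of finite order of `A`
be killed by `2^u * m` with `m` odd (for `A = E(ℚ)`: `t = 2^u m = gcd_ℓ #E(𝔽_ℓ)`, a multiple of
`#E(ℚ)_tors` by injectivity of torsion, Silverman AEC VII.3.1(b)), and let `φ₁, φ₂, φ₃` be
homomorphisms (reductions modulo three good odd primes) with `φ₁ P₁ ∉ 2B₁ + B₁[2^u]`,
`φ₂ P₂ ∉ 2B₂ + B₂[2^u]`, `φ₃ (P₁ + P₂) ∉ 2B₃ + B₃[2^u]`. Then `P₁, P₂` are `ℤ`-linearly independent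
in `A` (equivalently, independent modulo torsion). This is the certificate's `method_v2`
(`ffcurve.witness_independence_v2`) and engine B's `2`-adic coset criterion.
[cite: SilvermanAEC2009, VII.3.1(b)] [cite: CremonaAlgorithms1997, §3.5] -/
theorem linearIndependent_pair_of_cosetWitness {B₁ B₂ B₃ : Type*} [AddCommGroup B₁]
    [AddCommGroup B₂] [AddCommGroup B₃] {u : ℕ} {m : ℤ} (hm : Odd m)
    (htors : ∀ x : A, IsOfFinAddOrder x → ((2 : ℤ) ^ u * m) • x = 0) {P₁ P₂ : A}
    (φ₁ : A →+ B₁) (φ₂ : A →+ B₂) (φ₃ : A →+ B₃) (h₁ : φ₁ P₁ ∉ twoCoset B₁ u)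
    (h₂ : φ₂ P₂ ∉ twoCoset B₂ u) (h₃ : φ₃ (P₁ + P₂) ∉ twoCoset B₃ u) :
    LinearIndependent ℤ ![P₁, P₂] := by
  rw [LinearIndependent.pair_iff]
  intro a b hab
  by_contra hne
  have hg : 0 < Int.gcd a b := Int.gcd_pos_iff.mpr (not_and_or.mp hne)
  obtain ⟨g, a', b', hg0, hcop, rfl, rfl⟩ := Int.exists_gcd_one' hg
  -- the primitive combination `Q = a' • P₁ + b' • P₂` has finite order, `g • Q = 0`
  have hgQ : (g : ℤ) • (a' • P₁ + b' • P₂) = 0 := by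
    rw [smul_add, ← mul_smul, ← mul_smul, mul_comm (g : ℤ) a', mul_comm (g : ℤ) b']
    exact hab
  have hQfin : IsOfFinAddOrder (a' • P₁ + b' • P₂) :=
    isOfFinAddOrder_iff_nsmul_eq_zero.mpr ⟨g, hg0, by rw [← natCast_zsmul]; exact hgQ⟩
  have hQt : ((2 : ℤ) ^ u * m) • (a' • P₁ + b' • P₂) = 0 := htors _ hQfin
  rcases Int.even_or_odd a' with ha | ha <;> rcases Int.even_or_odd b' with hb | hb
  · -- both even: impossible since `gcd a' b' = 1`
    obtain ⟨r, hr⟩ := ha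
    obtain ⟨s, hs⟩ := hb
    obtain ⟨x, y, hxy⟩ := Int.isCoprime_iff_gcd_eq_one.mpr hcop
    have h2 : (2 : ℤ) ∣ 1 := ⟨x * r + y * s, by rw [← hxy, hr, hs]; ring⟩
    omega
  · -- `a'` even, `b'` odd: `b' • φ₂ P₂ ≡ φ₂ Q (mod 2•B₂)`
    obtain ⟨r, hr⟩ := ha
    refine h₂ (mem_twoCoset_of_odd_zsmul_mem hb ?_)
    have e : b' • φ₂ P₂ = φ₂ (a' • P₁ + b' • P₂) - (2 : ℤ) • (r • φ₂ P₁) := by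
      simp only [map_add, map_zsmul, hr]
      module
    rw [e]
    exact sub_mem (map_mem_twoCoset_of_zsmul_eq_zero φ₂ hm hQt) (two_zsmul_mem_twoCoset u _)
  · -- `a'` odd, `b'` even: `a' • φ₁ P₁ ≡ φ₁ Q (mod 2•B₁)`
    obtain ⟨s, hs⟩ := hb
    refine h₁ (mem_twoCoset_of_odd_zsmul_mem ha ?_)
    have e : a' • φ₁ P₁ = φ₁ (a' • P₁ + b' • P₂) - (2 : ℤ) • (s • φ₁ P₂) := by
      simp only [map_add, map_zsmul, hs]
      module
    rw [e]
    exact sub_mem (map_mem_twoCoset_of_zsmul_eq_zero φ₁ hm hQt) (two_zsmul_mem_twoCoset u _)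
  · -- both odd: `φ₃ (P₁ + P₂) ≡ φ₃ Q (mod 2•B₃)`
    obtain ⟨r, hr⟩ := ha
    obtain ⟨s, hs⟩ := hb
    refine h₃ ?_
    have e : φ₃ (P₁ + P₂) = φ₃ (a' • P₁ + b' • P₂) - (2 : ℤ) • (r • φ₃ P₁ + s • φ₃ P₂) := by
      simp only [map_add, map_zsmul, hr, hs]
      module
    rw [e]
    exact sub_mem (map_mem_twoCoset_of_zsmul_eq_zero φ₃ hm hQt) (two_zsmul_mem_twoCoset u _)

end Algebra

/-! ### Consequence for the rank -/

/-- **Coset witness ⇒ `rank_ℤ E(ℚ) ≥ 2`**, unconditionally in the witness data: combine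
`linearIndependent_pair_of_cosetWitness` with `two_le_mordellWeilRank_of_linearIndependent`
(Mordell–Weil proved in the tree). [cite: SilvermanAEC2009, Thm. VIII.6.7] -/
theorem two_le_mordellWeilRank_of_cosetWitness (W : WeierstrassCurve ℚ) [W.IsElliptic]
    {B₁ B₂ B₃ : Type*} [AddCommGroup B₁] [AddCommGroup B₂] [AddCommGroup B₃] {u : ℕ} {m : ℤ}
    (hm : Odd m) (htors : ∀ x : W.toAffine.Point, IsOfFinAddOrder x → ((2 : ℤ) ^ u * m) • x = 0)
    {P₁ P₂ : W.toAffine.Point} (φ₁ : W.toAffine.Point →+ B₁) (φ₂ : W.toAffine.Point →+ B₂)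
    (φ₃ : W.toAffine.Point →+ B₃) (h₁ : φ₁ P₁ ∉ twoCoset B₁ u) (h₂ : φ₂ P₂ ∉ twoCoset B₂ u)
    (h₃ : φ₃ (P₁ + P₂) ∉ twoCoset B₃ u) : 2 ≤ W.mordellWeilRank :=
  two_le_mordellWeilRank_of_linearIndependent W
    (linearIndependent_pair_of_cosetWitness hm htors φ₁ φ₂ φ₃ h₁ h₂ h₃)

/-- **Census form**: for a row of the rank-2 table with `check = true`, three coset witnesses for
the LISTED generators `gen₁, gen₂` give the named hypothesis `hlow : 2 ≤ rank_ℤ E(ℚ)` of the row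
theorems (`Rank2Row.analyticRank_eq_rank`, …) — what the certificate field `rank_lower.v2_witnesses`
records, up to the reduction homomorphisms themselves. [cite: SilvermanAEC2009, VII.3.1(b)] -/
theorem Rank2Row.two_le_mordellWeilRank_of_cosetWitness (r : Rank2Row) (h : r.check = true)
    {B₁ B₂ B₃ : Type*} [AddCommGroup B₁] [AddCommGroup B₂] [AddCommGroup B₃] {u : ℕ} {m : ℤ}
    (hm : Odd m)
    (htors : ∀ x : r.curve.toAffine.Point, IsOfFinAddOrder x → ((2 : ℤ) ^ u * m) • x = 0)
    (φ₁ : r.curve.toAffine.Point →+ B₁) (φ₂ : r.curve.toAffine.Point →+ B₂)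
    (φ₃ : r.curve.toAffine.Point →+ B₃) (h₁ : φ₁ (r.gen₁ h) ∉ twoCoset B₁ u)
    (h₂ : φ₂ (r.gen₂ h) ∉ twoCoset B₂ u) (h₃ : φ₃ (r.gen₁ h + r.gen₂ h) ∉ twoCoset B₃ u) :
    2 ≤ r.curve.mordellWeilRank :=
  r.two_le_mordellWeilRank h (linearIndependent_pair_of_cosetWitness hm htors φ₁ φ₂ φ₃ h₁ h₂ h₃)

end Summit.BirchSwinnertonDyer.BirchSwinnertonDyer.Rank2Observatory
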